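import Summits.QuantumFields.YangMills.Theorems.RationalShortRootRigidityHyperplaneVanishing
import HarnessLib

/-!
# `RationalShortRootRigidity` — Step 4 helper (m19): the even-in-`p₀` lift `N = Ñ(p₀², q)`

Helper lemma INSIDE the paper proof of crux `stmt-QuantumFields-23124` (`F4SubCurvatureDoor.RationalShortRootRigidity`,
LINE g15-A of planner ym-idea-3; Step 4 = `stub_alternation`, Chevalley-free plan HOME l15/STUB-PLAN-Alternation.md; free-hands
menu V, item (m19), statement typed in HOME l15/Helpers23124d.lean as `Helpers.EvenInX0Lift` — proved here DEF-FREE, with the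
route-posited substitution `sqLift M = aeval (p₀ ↦ p₀², q ↦ q) M` written out (definitionally equal to `Helpers.sqLift`)):

**Lemma** (`evenInX0Lift`).  A real polynomial `N(p₀, q)` even in `p₀` is `Ñ(p₀², q)` for some polynomial `Ñ`.

Proof.  The evenness is an algebraic identity `bind₁ σ N = N` (`σ : p₀ ↦ −p₀`, by `MvPolynomial.funext`); read `N` as
`P ∈ ℝ[q][p₀]` (`finSuccEquiv`), where it says `P ∘ (−X) = P`, i.e. the odd coefficients vanish (`coeff_comp_neg_X`); then
`P = expand 2 (contract 2 P)` coefficientwise, and `expand 2` corresponds to the substitution `p₀ ↦ p₀²` under `finSuccEquiv`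
(an algebra-hom identity checked on generators, `Polynomial.algHom_ext'` / `MvPolynomial.algHom_ext`).

Mathlib + the tree lemma `eval_bind₁_gen` (p665739); THEOREMS ONLY (no definitions); no named facts; no `sorry`; default heartbeats.
Nothing about the crux 23124, the route's rung or the Yang–Mills mass gap is proved here.  Free-hands seat `ym-line-frs-p2` g10,
`--supports stmt-QuantumFields-23124`.
-/

set_option autoImplicit false

namespace Summit.QuantumFields.YangMills.Theorems.RationalShortRootRigidity

open Polynomial
open scoped BigOperators Polynomial

/-- Coefficients of `P ∘ (−X)`: `coeff n (P.comp (−X)) = (−1)^n coeff n P`. [folklore] -/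
theorem coeff_comp_neg_X' {R : Type*} [CommRing R] (P : R[X]) (n : ℕ) :
    (P.comp (-X)).coeff n = (-1) ^ n * P.coeff n := by
  rw [comp, eval₂_eq_sum_range, finsetSum_coeff]
  have hterm : ∀ i, (C (P.coeff i) * (-X : R[X]) ^ i).coeff n = if n = i then (-1) ^ i * P.coeff i else 0 := by
    intro i
    have h1 : C (P.coeff i) * (-X : R[X]) ^ i = C (P.coeff i * (-1) ^ i) * X ^ i := by
      rw [neg_pow, map_mul, map_pow, map_neg, map_one]; ring
    rw [h1, coeff_C_mul_X_pow]
    split_ifs <;> ring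
  simp_rw [hterm]
  rw [Finset.sum_ite_eq]
  split_ifs with h
  · rfl
  · rw [Finset.mem_range, not_lt] at h
    rw [coeff_eq_zero_of_natDegree_lt (by omega), mul_zero]

/-- Under `finSuccEquiv`, the reflection `p₀ ↦ −p₀` becomes `P ↦ P ∘ (−X)`. [folklore] -/
theorem finSuccEquiv_bind₁_neg (N : MvPolynomial (Fin 4) ℝ) :
    MvPolynomial.finSuccEquiv ℝ 3
        (MvPolynomial.bind₁ (fun i : Fin 4 => if i = 0 then -MvPolynomial.X 0 else MvPolynomial.X i) N) =
      (MvPolynomial.finSuccEquiv ℝ 3 N).comp (-X) := by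
  set F₁ : MvPolynomial (Fin 4) ℝ →ₐ[ℝ] (MvPolynomial (Fin 3) ℝ)[X] :=
    (MvPolynomial.finSuccEquiv ℝ 3).toAlgHom.comp
      (MvPolynomial.bind₁ (fun i : Fin 4 => if i = 0 then -MvPolynomial.X 0 else MvPolynomial.X i)) with hF₁
  set F₂ : MvPolynomial (Fin 4) ℝ →ₐ[ℝ] (MvPolynomial (Fin 3) ℝ)[X] :=
    ((Polynomial.aeval (-X : (MvPolynomial (Fin 3) ℝ)[X])).restrictScalars ℝ).comp
      (MvPolynomial.finSuccEquiv ℝ 3).toAlgHom with hF₂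
  have hF : F₁ = F₂ := by
    refine MvPolynomial.algHom_ext fun i => ?_
    refine Fin.cases ?_ (fun j => ?_) i
    · simp [hF₁, hF₂, MvPolynomial.finSuccEquiv_X_zero]
    · simp [hF₁, hF₂, MvPolynomial.finSuccEquiv_X_succ, Fin.succ_ne_zero]
  have := congrArg (fun F => F N) hF
  simpa [hF₁, hF₂, comp_eq_aeval] using this

/-- Under `finSuccEquiv`, the substitution `p₀ ↦ p₀²` becomes `expand 2`. [folklore] -/
theorem aeval_sq_finSuccEquiv_symm (Q : (MvPolynomial (Fin 3) ℝ)[X]) :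
    MvPolynomial.aeval (fun i : Fin 4 => if i = 0 then (MvPolynomial.X 0 : MvPolynomial (Fin 4) ℝ) ^ 2 else MvPolynomial.X i)
        ((MvPolynomial.finSuccEquiv ℝ 3).symm Q) =
      (MvPolynomial.finSuccEquiv ℝ 3).symm (expand (MvPolynomial (Fin 3) ℝ) 2 Q) := by
  have hsymmX : (MvPolynomial.finSuccEquiv ℝ 3).symm X = MvPolynomial.X 0 := by
    rw [← MvPolynomial.finSuccEquiv_X_zero, AlgEquiv.symm_apply_apply]
  have hsymmC : ∀ j : Fin 3, (MvPolynomial.finSuccEquiv ℝ 3).symm (C (MvPolynomial.X j)) = MvPolynomial.X (Fin.succ j) := by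
    intro j
    rw [← MvPolynomial.finSuccEquiv_X_succ, AlgEquiv.symm_apply_apply]
  set G₁ : (MvPolynomial (Fin 3) ℝ)[X] →ₐ[ℝ] MvPolynomial (Fin 4) ℝ :=
    (MvPolynomial.aeval (fun i : Fin 4 =>
      if i = 0 then (MvPolynomial.X 0 : MvPolynomial (Fin 4) ℝ) ^ 2 else MvPolynomial.X i)).comp
      (MvPolynomial.finSuccEquiv ℝ 3).symm.toAlgHom with hG₁
  set G₂ : (MvPolynomial (Fin 3) ℝ)[X] →ₐ[ℝ] MvPolynomial (Fin 4) ℝ :=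
    (MvPolynomial.finSuccEquiv ℝ 3).symm.toAlgHom.comp ((expand (MvPolynomial (Fin 3) ℝ) 2).restrictScalars ℝ) with hG₂
  have hG : G₁ = G₂ := by
    refine Polynomial.algHom_ext' (MvPolynomial.algHom_ext fun j => ?_) ?_
    · simp [hG₁, hG₂, hsymmC, Fin.succ_ne_zero]
    · simp [hG₁, hG₂, hsymmX]
  have := congrArg (fun G => G Q) hG
  simpa [hG₁, hG₂] using this

/-- **Even-in-`p₀` lift** (m19; Step 4 of the paper proof of 23124).  The statement is the body of `Helpers.EvenInX0Lift`
(HOME l15/Helpers23124d.lean) with the route's `sqLift` written out (`aeval (p₀ ↦ p₀², q ↦ q)`). [folklore] -/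
theorem evenInX0Lift :
    ∀ N : MvPolynomial (Fin 4) ℝ,
      (∀ p : Fin 4 → ℝ, MvPolynomial.eval (fun i => if i = 0 then -p 0 else p i) N = MvPolynomial.eval p N) →
      ∃ M : MvPolynomial (Fin 4) ℝ,
        N = MvPolynomial.aeval
          (fun i : Fin 4 => if i = 0 then (MvPolynomial.X 0 : MvPolynomial (Fin 4) ℝ) ^ 2 else MvPolynomial.X i) M := by
  intro N hN
  -- algebraic evenness
  have hbind : MvPolynomial.bind₁ (fun i : Fin 4 => if i = 0 then -MvPolynomial.X 0 else MvPolynomial.X i) N = N := by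
    apply MvPolynomial.funext
    intro v
    rw [eval_bind₁_gen]
    have hpt : (fun i : Fin 4 => MvPolynomial.eval v ((fun j : Fin 4 =>
        if j = 0 then -MvPolynomial.X 0 else MvPolynomial.X j) i)) = fun i => if i = 0 then -v 0 else v i := by
      funext i
      by_cases hi : i = 0
      · subst hi; simp
      · simp [hi]
    rw [hpt]
    exact hN v
  -- the odd coefficients of `P = N ∈ ℝ[q][p₀]` vanish
  set P : (MvPolynomial (Fin 3) ℝ)[X] := MvPolynomial.finSuccEquiv ℝ 3 N with hP
  have hodd : ∀ n : ℕ, ¬ 2 ∣ n → P.coeff n = 0 := by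
    intro n hn
    have h1 := congrArg (fun p : (MvPolynomial (Fin 3) ℝ)[X] => p.coeff n) (finSuccEquiv_bind₁_neg N)
    simp only [hbind] at h1
    rw [← hP, coeff_comp_neg_X', (Nat.odd_iff.2 (Nat.two_dvd_ne_zero.1 hn)).neg_one_pow, neg_one_mul] at h1
    -- h1 : P.coeff n = -P.coeff n
    have h2 : (2 : (MvPolynomial (Fin 3) ℝ)) • P.coeff n = 0 := by rw [two_smul]; nth_rewrite 2 [h1]; exact add_neg_cancel _
    exact (smul_eq_zero.1 h2).resolve_left two_ne_zero
  -- `P = expand 2 (contract 2 P)`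
  have hPQ : expand (MvPolynomial (Fin 3) ℝ) 2 (contract 2 P) = P := by
    refine Polynomial.ext fun n => ?_
    rw [coeff_expand two_pos, coeff_contract two_ne_zero]
    split_ifs with h
    · rw [Nat.div_mul_cancel h]
    · exact (hodd n h).symm
  refine ⟨(MvPolynomial.finSuccEquiv ℝ 3).symm (contract 2 P), ?_⟩
  rw [aeval_sq_finSuccEquiv_symm, hPQ, hP, AlgEquiv.symm_apply_apply]

end Summit.QuantumFields.YangMills.Theorems.RationalShortRootRigidity
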